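import Mathlib
import HarnessLib
import Summits.NavierStokesRegularity.NavierStokesRegularity.Theorems.PoloidalWindowDoorPoloidalWindowRigidityThmAClass

/-!
# Theorem A, census form: the semi-elliptic stub reduces to its THICK part

Seat ns-poloidal-K2-p2 g6 (interim lead-of-record on crux K2 `PoloidalWindowRigidity` = stmt-NavierStokesRegularity-19708;
line `mixed_type` v1; item stmt-20428 `LrcModEntire`).  Consequence of the class form of Theorem A
(`…ThmAClass.not_timeHeightShear_semiElliptic`) for the `mixed_type` skeleton (cstrat-19708): its stub `stub_semiElliptic`
(non-degenerate + pinned + twisting window inside a slab of SEMI-ELLIPTIC slices ⇒ regular) follows, for the same profile, from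
its THICK part alone:

* `semiElliptic_regular_of_thick` — IF every such window that is moreover THICK (the shear slope is a function of `(t, x₂)` on
  NO nonempty open sub-window) forces `¬ IsBackwardSingularPoint v 0`, THEN every such window does: a (TH) sub-window `W₁` would
  contain a non-degenerate point whose slice, lying in the semi-elliptic slab, contradicts `not_timeHeightShear_semiElliptic`.

So the registered stub may be re-cut as `stub_semiEllipticThick` (:= the hypothesis `hThick` below, verbatim `stub_semiElliptic` plus
the thickness clause of `stub_hyperbolicThick`), and with `…ThmARelocation.twistingTH_regular_of_hyperbolicTH` the twisting residue of
crux 19708 reads `{stub_hyperbolicTH, stub_hyperbolicThick, stub_semiEllipticThick}` — (TH) appears ONLY in its hyperbolic dress.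
WHAT THIS IS NOT: not a proof of K2 and not a claim about Navier–Stokes regularity (bears_on LADDER-NS N0 via crux 19708 / item 20428).
-/

-- the summit and its single sub-problem share the name (CONVENTIONS §1)
set_option linter.dupNamespace false

noncomputable section

namespace Summit.NavierStokesRegularity.NavierStokesRegularity.Theorems.PoloidalWindowDoorPoloidalWindowRigidityThmASemiEllipticThick

open Set Function Filter Topology Metric
open scoped RealInnerProductSpace InnerProductSpace
open Literature.Analysis Literature.Analysis.FluidPDE
open Summit.NavierStokesRegularity.NavierStokesRegularity.Theorems.PoloidalWindowDoorPoloidalWindowRigidityThmAClass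

/-- **SEMI-ELLIPTIC ⇒ REGULAR reduces to SEMI-ELLIPTIC THICK ⇒ REGULAR.**  Class profile (Type-I, continuous, Oseen-mild,
div-free, poloidal).  Hypothesis `hThick`: the `mixed_type` stub `stub_semiElliptic` restricted to THICK windows (extra last
hypothesis: on no nonempty open `W₁ ⊆ W` is the shear slope a function of `(t, x₂)`).  Conclusion: `stub_semiElliptic` for this
profile, verbatim. [folklore] -/
theorem semiElliptic_regular_of_thick (C : ℝ) (v : ℝ → EuclideanSpace ℝ (Fin 3) → EuclideanSpace ℝ (Fin 3))
    (hrate : Literature.Analysis.FluidPDE.HasTypeITimeDecay C v)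
    (hcont : ContinuousOn (Function.uncurry v) (Set.Iio (0 : ℝ) ×ˢ Set.univ))
    (hmild : ∀ s t : ℝ, s < t → t < 0 → ∀ x, v t x =
      Literature.Analysis.UnboundedOperators.heatExtension (v s) (t - s) x -
        Literature.Analysis.FluidPDE.oseenDuhamel 1 s v v t x)
    (hdiv : ∀ t < 0, Literature.Analysis.FluidPDE.VectorCalculus.IsDivFree (v t))
    (hThick : ∀ W' : Set (ℝ × EuclideanSpace ℝ (Fin 3)), IsOpen W' → W'.Nonempty → W' ⊆ Set.Iio (0 : ℝ) ×ˢ Set.univ →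
      (∀ z ∈ W', Literature.Analysis.FluidPDE.curl (v z.1) z.2 ≠ 0 ∧
        (fderiv ℝ (v z.1) z.2 (EuclideanSpace.single 0 1) 2 ≠ 0 ∨ fderiv ℝ (v z.1) z.2 (EuclideanSpace.single 1 1) 2 ≠ 0) ∧
        (fderiv ℝ (v z.1) z.2 (EuclideanSpace.single 2 1) 0 ≠ 0 ∨ fderiv ℝ (v z.1) z.2 (EuclideanSpace.single 2 1) 1 ≠ 0)) →
      (∀ m : ℝ → ℝ, ∀ W₁ : Set (ℝ × EuclideanSpace ℝ (Fin 3)), W₁ ⊆ W' → IsOpen W₁ → W₁.Nonempty →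
        ∃ z ∈ W₁, ∃ b : Fin 3, b ≠ 2 ∧
          fderiv ℝ (v z.1) z.2 (EuclideanSpace.single 2 1) b ≠
            m z.1 * fderiv ℝ (v z.1) z.2 (EuclideanSpace.single b 1) 2) →
      (∀ z ∈ W',
        fderiv ℝ (fun x => fderiv ℝ (v z.1) x (EuclideanSpace.single 2 1) 2) z.2 (EuclideanSpace.single 0 1) *
            fderiv ℝ (v z.1) z.2 (EuclideanSpace.single 1 1) 2 -
          fderiv ℝ (fun x => fderiv ℝ (v z.1) x (EuclideanSpace.single 2 1) 2) z.2 (EuclideanSpace.single 1 1) *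
            fderiv ℝ (v z.1) z.2 (EuclideanSpace.single 0 1) 2 ≠ 0) →
      ∀ a b : ℝ, W' ⊆ Set.Ioo a b ×ˢ Set.univ →
        (∀ s ∈ Set.Ioo a b, ∀ y : EuclideanSpace ℝ (Fin 3),
          0 ≤ fderiv ℝ (v s) y (EuclideanSpace.single 2 1) 0 * fderiv ℝ (v s) y (EuclideanSpace.single 0 1) 2 +
            fderiv ℝ (v s) y (EuclideanSpace.single 2 1) 1 * fderiv ℝ (v s) y (EuclideanSpace.single 1 1) 2) →
        (∀ m : ℝ → ℝ → ℝ, ∀ W₁ : Set (ℝ × EuclideanSpace ℝ (Fin 3)), W₁ ⊆ W' → IsOpen W₁ → W₁.Nonempty →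
          ∃ z ∈ W₁, ∃ b : Fin 3, b ≠ 2 ∧
            fderiv ℝ (v z.1) z.2 (EuclideanSpace.single 2 1) b ≠
              m z.1 (z.2 2) * fderiv ℝ (v z.1) z.2 (EuclideanSpace.single b 1) 2) →
        ¬ Literature.Analysis.FluidPDE.IsBackwardSingularPoint v 0)
    (W : Set (ℝ × EuclideanSpace ℝ (Fin 3))) (hW : IsOpen W) (hWne : W.Nonempty) (hWs : W ⊆ Set.Iio (0 : ℝ) ×ˢ Set.univ)
    (hnd : ∀ z ∈ W, Literature.Analysis.FluidPDE.curl (v z.1) z.2 ≠ 0 ∧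
      (fderiv ℝ (v z.1) z.2 (EuclideanSpace.single 0 1) 2 ≠ 0 ∨ fderiv ℝ (v z.1) z.2 (EuclideanSpace.single 1 1) 2 ≠ 0) ∧
      (fderiv ℝ (v z.1) z.2 (EuclideanSpace.single 2 1) 0 ≠ 0 ∨ fderiv ℝ (v z.1) z.2 (EuclideanSpace.single 2 1) 1 ≠ 0))
    (hpin : ∀ m : ℝ → ℝ, ∀ W₁ : Set (ℝ × EuclideanSpace ℝ (Fin 3)), W₁ ⊆ W → IsOpen W₁ → W₁.Nonempty →
      ∃ z ∈ W₁, ∃ b : Fin 3, b ≠ 2 ∧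
        fderiv ℝ (v z.1) z.2 (EuclideanSpace.single 2 1) b ≠
          m z.1 * fderiv ℝ (v z.1) z.2 (EuclideanSpace.single b 1) 2)
    (htw : ∀ z ∈ W,
      fderiv ℝ (fun x => fderiv ℝ (v z.1) x (EuclideanSpace.single 2 1) 2) z.2 (EuclideanSpace.single 0 1) *
          fderiv ℝ (v z.1) z.2 (EuclideanSpace.single 1 1) 2 -
        fderiv ℝ (fun x => fderiv ℝ (v z.1) x (EuclideanSpace.single 2 1) 2) z.2 (EuclideanSpace.single 1 1) *
          fderiv ℝ (v z.1) z.2 (EuclideanSpace.single 0 1) 2 ≠ 0)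
    (a b : ℝ) (hWab : W ⊆ Set.Ioo a b ×ˢ Set.univ)
    (hsemi : ∀ s ∈ Set.Ioo a b, ∀ y : EuclideanSpace ℝ (Fin 3),
      0 ≤ fderiv ℝ (v s) y (EuclideanSpace.single 2 1) 0 * fderiv ℝ (v s) y (EuclideanSpace.single 0 1) 2 +
        fderiv ℝ (v s) y (EuclideanSpace.single 2 1) 1 * fderiv ℝ (v s) y (EuclideanSpace.single 1 1) 2) :
    ¬ Literature.Analysis.FluidPDE.IsBackwardSingularPoint v 0 := by
  by_cases hTH : ∃ m : ℝ → ℝ → ℝ, ∃ W₁ : Set (ℝ × EuclideanSpace ℝ (Fin 3)), W₁ ⊆ W ∧ IsOpen W₁ ∧ W₁.Nonempty ∧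
      ∀ z ∈ W₁, ∀ b : Fin 3, b ≠ 2 →
        fderiv ℝ (v z.1) z.2 (EuclideanSpace.single 2 1) b =
          m z.1 (z.2 2) * fderiv ℝ (v z.1) z.2 (EuclideanSpace.single b 1) 2
  · -- a (TH) sub-window: contradiction with Theorem A (class form)
    exfalso
    obtain ⟨m, W₁, hW₁W, hW₁, ⟨z₀, hz₀⟩, hid⟩ := hTH
    obtain ⟨-, hnd1, hnd2⟩ := hnd z₀ (hW₁W hz₀)
    exact not_timeHeightShear_semiElliptic hrate hcont hmild hdiv hW₁ ⟨z₀, hz₀⟩ (hW₁W.trans hWs) hid hz₀ hnd1 hnd2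
      (hsemi z₀.1 (hWab (hW₁W hz₀)).1)
  · -- THICK window
    push Not at hTH
    refine hThick W hW hWne hWs hnd hpin htw a b hWab hsemi fun m W₁ h1 h2 h3 => ?_
    obtain ⟨z, hz, b', hb', hne⟩ := hTH m W₁ h1 h2 h3
    exact ⟨z, hz, b', hb', hne⟩

end Summit.NavierStokesRegularity.NavierStokesRegularity.Theorems.PoloidalWindowDoorPoloidalWindowRigidityThmASemiEllipticThick

end
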